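/-
Copyright (c) 2026 the pub-hodgecm-mathlib formalisation cell (harness21).  Prover seat hodgecm-mathlib-K2E5-p09 (g0),
Track B «K2-LIT» ∕ h413, engine E5 «TamagawaUnitary», unit DET-SECTION, file p09: payment of the socket
`K2E5TamagawaUnitary.DetSection.sig_K2E5DetRationalSurjective` — THE DETERMINANT `det : U(h)(L⁺) → L¹` OF A HERMITIAN PLANE HAS AN
EXPLICIT HOMOMORPHIC SECTION (no Hilbert 90).  2026-09-03.
-/
import Literature.NumberTheory.Automorphic.AdelicUnitaryGroup    -- ★ `cmConjRingHom`, `cmConjRingHom_apply` (complex conjugation of a CM field as a ring hom)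
import HarnessLib

/-!
# K2_E5 road (h413 = stmt-HodgeConjecture-24833), unit DET-SECTION, file p09:
# `det : U(h)(L⁺) → L¹ = {z ∈ L | z̄ z = 1}` is surjective, by an explicit multiplicative section

Cell `pub/hodgecm-mathlib` (D-0151), Track B (21-frontier RULING «PUSH BOTH» 2026-09-03, director req624, chair K2-lead ORDER #1 §4.4 ∕
ORDER #2, SKELETON LANDED K2E5 2026-09-03T21:31:58Z), socket module
`Summits/HodgeConjecture/HodgeConjecture/Cruxes/H413/Lines/K2_E5_TamagawaUnitary_DetSection.lean` (planner K2E5-plan (g0), ED. 1 sha16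
e27192c58e78046a, commit 5818578a550f; ED. 2 sha16 f186e7c7a1562d71, socket bytes unchanged), socket **`sig_K2E5DetRationalSurjective`** (ED. 2 :53, size S; second rung of the chain
DET-1 `…HermitianDiagonalBasis` → DET-2 (this file) → DET-5 `…RationalImage` → tier-0 stub S2 `stub_detFibrationTransfer`).

THE MATHEMATICS [Rogawski1990, §1.9 p. 9 (unitary groups of hermitian forms over a CM field; the diagonal tori); §14.5 p. 238]
[PlatonovRapinchuk1994, §2.3 (unitary groups: `U(h)/SU(h) ≅ U(1)` via `det`)].  Let `L` be a CM field with complex conjugation `σ = x ↦ x̄`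
(★ `cmConjRingHom L`), and `h ∈ M₂(L)` hermitian (`(h.map σ)ᵀ = h`) and non-degenerate (`det h ≠ 0`).  The socket's docstring proposes the
section `z ↦ P·diag(z, 1)·P⁻¹` in a diagonalising basis `P` (DET-1).  ROAD TAKEN HERE (self-contained, independent of DET-1, basis-free):
the **unitary quasi-reflection** along ONE anisotropic vector `v` (`q := v̄ᵀ h v ≠ 0`),
`s(z) := 1 + (z − 1)·π_v`, `π_v := q⁻¹ · v · (v̄ᵀ h)` (the `h`-orthogonal projector onto the line `L v`; in Mathlib terms
`π_v = q⁻¹ • vecMulVec v ((σ ∘ v) ᵥ* h)`).  Since `π_v² = π_v` (because `(v̄ᵀ h) v = q`), `s(zw) = s(z) s(w)` for ALL `z, w ∈ L` and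
`s(1) = 1`; by the matrix-determinant lemma `det s(z) = 1 + (z − 1) q⁻¹ q = z`; and since `π_v` is `h`-self-adjoint
(`π̄_vᵀ h = h π_v`, which is `q̄ = q`), `s(z)̄ᵀ h s(z) = h + (z̄ + z − 2 + (z̄ − 1)(z − 1))·q⁻¹·h π_v = h + (z̄ z − 1) q⁻¹ · h π_v = h`
whenever `z̄ z = 1`.  An anisotropic `v` exists for every non-degenerate hermitian PLANE in characteristic `≠ 2`: `e₀` if `h₀₀ ≠ 0`, `e₁` if
`h₁₁ ≠ 0`, and otherwise (`h` is the hyperbolic plane `[[0, β], [β̄, 0]]`, `β ≠ 0`) `v = (β, 1)` with `q = 2 β β̄ ≠ 0`.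
(This is the `n = 2` case of the standard fact that `det` restricted to the torus fixing an anisotropic line's orthogonal complement is an
isomorphism onto `U(1)`; Platonov–Rapinchuk §2.3.)

* §1 generic core over any field `K` with a ring endomorphism `σ` (no involution or hermitian hypothesis until needed), any finite index type:
  `one_add_smul_vecMulVec_mul` (product of two quasi-reflections along the same pair `(v, w)`), `det_one_add_smul_vecMulVec`
  (matrix-determinant lemma), `conj_gramRow` ∕ `conj_gram` (`σ ∘ (v̄ᵀ h) = h v` and `q̄ = q` for hermitian `h`, involutive `σ`),
  `conjTranspose_quasiReflection_mul` (the adjoint identity `s̄ᵀ h s = h + (ā + a + ā a q)·(h v)(v̄ᵀ h)`), and the assembly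
  `exists_section_of_anisotropic` (the four socket clauses from one anisotropic vector);
* §2 `exists_anisotropic_fin_two` — a non-degenerate hermitian `2 × 2` matrix has an anisotropic vector (`char K = 0` suffices);
* §3 the head **`detRationalSurjective`** — `sig_K2E5DetRationalSurjective` TOKEN FOR TOKEN
  (by-name tie `example : type_of% @detRationalSurjective = type_of% @K2E5TamagawaUnitary.DetSection.sig_K2E5DetRationalSurjective := rfl`
  checked at home by paste, and by import once the socket module is BUILT).

HONEST LABEL.  HC_CM is proved only modulo the 7 printed citations (2 remaining named inputs: hLiu418 = `stmt-HodgeConjecture-24832`, h413 =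
`stmt-HodgeConjecture-24833`) until rung 0 closes; this file is a `--supports stmt-HodgeConjecture-24833 --as helper` payment and moves no counter.

## References
* [Rogawski1990] J. D. Rogawski, *Automorphic Representations of Unitary Groups in Three Variables*, Ann. of Math. Stud. 123, Princeton UP
  (1990) — §1.9 p. 9 (hermitian forms over `E/F`, unitary groups, diagonal forms `Φ`), §14.5 pp. 238–239 (the lattices along `det`).
* [PlatonovRapinchuk1994] V. Platonov, A. Rapinchuk, *Algebraic Groups and Number Theory*, Pure Appl. Math. 139, Academic Press (1994) —
  §2.3 (classical groups; unitary groups of hermitian forms, `SU(h) = ker det`, `det : U(h) → U(1)` split by a one-dimensional torus).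
-/

set_option autoImplicit false
-- the mandated namespace repeats the single-problem summit's segment (`HodgeConjecture.HodgeConjecture`)
set_option linter.dupNamespace false

noncomputable section

open NumberField

namespace Summit.HodgeConjecture.HodgeConjecture.Cruxes.H413.K2E5DetRationalSurjective

open Matrix Literature.NumberTheory.Automorphic

/-! ## §1 Generic core: the unitary quasi-reflection along a vector -/

section Generic

variable {K : Type*} [Field K] {n : Type*} [Fintype n] [DecidableEq n]

/-- **product of two quasi-reflections along the same pair `(v, w)`**: with `V = v wᵀ` (`vecMulVec v w`) and `q = wᵀ v`,
`(1 + a V)(1 + b V) = 1 + (a + b + a b q) V`, because `V² = q V`. [folklore] -/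
theorem one_add_smul_vecMulVec_mul (v w : n → K) (a b : K) :
    (1 + a • vecMulVec v w) * (1 + b • vecMulVec v w) = 1 + (a + b + a * b * (w ⬝ᵥ v)) • vecMulVec v w := by
  have hVV : vecMulVec v w * vecMulVec v w = (w ⬝ᵥ v) • vecMulVec v w := by
    rw [vecMulVec_mul_vecMulVec, vecMulVec_smul]
  simp only [add_mul, mul_add, one_mul, mul_one, smul_mul_assoc, mul_smul_comm, smul_smul, hVV]
  module

/-- **matrix-determinant lemma for a quasi-reflection**: `det (1 + a · v wᵀ) = 1 + a · wᵀ v`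
(Mathlib `Matrix.det_one_add_replicateCol_mul_replicateRow`). [folklore] -/
theorem det_one_add_smul_vecMulVec (v w : n → K) (a : K) :
    (1 + a • vecMulVec v w).det = 1 + a * (w ⬝ᵥ v) := by
  rw [← smul_vecMulVec, vecMulVec_eq (ι := Unit), det_one_add_replicateCol_mul_replicateRow, dotProduct_smul,
    smul_eq_mul]

variable (σ : K →+* K) (H : Matrix n n K) (v : n → K)

omit [DecidableEq n] in
/-- For an involutive `σ` and a `σ`-hermitian `H` (`(H.map σ)ᵀ = H`), the conjugate of the Gram row `v̄ᵀ H` of a vector `v` is the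
column `H v`: `σ ∘ ((σ ∘ v) ᵥ* H) = H *ᵥ v`. [folklore] -/
theorem conj_gramRow (hσ : ∀ x, σ (σ x) = x) (hH : (H.map σ)ᵀ = H) :
    (⇑σ ∘ ((⇑σ ∘ v) ᵥ* H)) = H *ᵥ v := by
  have hHt : H.map σ = Hᵀ := by simpa only [transpose_transpose] using congrArg transpose hH
  have hvv : (⇑σ ∘ (⇑σ ∘ v)) = v := funext fun i => hσ (v i)
  funext j
  change σ (((⇑σ ∘ v) ᵥ* H) j) = (H *ᵥ v) j
  rw [RingHom.map_vecMul, hvv, hHt, vecMul_transpose]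

omit [DecidableEq n] in
/-- For an involutive `σ` and a `σ`-hermitian `H`, the hermitian Gram value `q = v̄ᵀ H v` is `σ`-fixed: `σ q = q`. [folklore] -/
theorem conj_gram (hσ : ∀ x, σ (σ x) = x) (hH : (H.map σ)ᵀ = H) :
    σ (((⇑σ ∘ v) ᵥ* H) ⬝ᵥ v) = ((⇑σ ∘ v) ᵥ* H) ⬝ᵥ v := by
  rw [RingHom.map_dotProduct, conj_gramRow σ H v hσ hH, dotProduct_comm, dotProduct_mulVec]

/-- **adjoint identity for a quasi-reflection**: for involutive `σ`, `σ`-hermitian `H`, a vector `v` with Gram row `w = v̄ᵀ H` and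
Gram value `q = w v`, and any scalar `a`,
`(1 + a v w)̄ᵀ · H · (1 + a v w) = H + (σ a + a + σ a · a · q) · (H v) w` — the `h`-self-adjointness of the projector `q⁻¹ v w`.
[folklore] -/
theorem conjTranspose_quasiReflection_mul (hσ : ∀ x, σ (σ x) = x) (hH : (H.map σ)ᵀ = H) (a : K) :
    ((1 + a • vecMulVec v ((⇑σ ∘ v) ᵥ* H)).map σ)ᵀ * H * (1 + a • vecMulVec v ((⇑σ ∘ v) ᵥ* H)) =
      H + (σ a + a + σ a * a * (((⇑σ ∘ v) ᵥ* H) ⬝ᵥ v)) • vecMulVec (H *ᵥ v) ((⇑σ ∘ v) ᵥ* H) := by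
  set w : n → K := (⇑σ ∘ v) ᵥ* H with hw
  -- conjugate-transpose of the quasi-reflection: `(1 + a v wᵀ)̄ᵀ = 1 + σ a · (σ ∘ w) (σ ∘ v)ᵀ = 1 + σ a · (H v) v̄ᵀ`
  have hmapV : (vecMulVec v w).map σ = vecMulVec (⇑σ ∘ v) (⇑σ ∘ w) := by
    ext i j
    simp only [map_apply, vecMulVec_apply, map_mul, Function.comp_apply]
  have hct : ((1 + a • vecMulVec v w).map σ)ᵀ = 1 + σ a • vecMulVec (H *ᵥ v) (⇑σ ∘ v) := by
    rw [Matrix.map_add _ (map_add σ), Matrix.map_one _ (map_zero σ) (map_one σ), Matrix.map_smul' _ _ _ (map_mul σ), hmapV,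
      hw, conj_gramRow σ H v hσ hH, transpose_add, transpose_one, transpose_smul, transpose_vecMulVec]
  have hVV : vecMulVec (H *ᵥ v) w * vecMulVec v w = (w ⬝ᵥ v) • vecMulVec (H *ᵥ v) w := by
    rw [vecMulVec_mul_vecMulVec, vecMulVec_smul]
  rw [hct]
  simp only [add_mul, mul_add, one_mul, mul_one, smul_mul_assoc, mul_smul_comm, smul_smul, vecMulVec_mul, mul_vecMulVec, ← hw,
    hVV]
  module

/-- **the section from one anisotropic vector**: for involutive `σ`, `σ`-hermitian `H` and `v` with `q = v̄ᵀ H v ≠ 0`, the quasi-reflections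
`s(z) = 1 + (z − 1) q⁻¹ · v (v̄ᵀ H)` form a multiplicative family on ALL of `K` with `s(1) = 1`, `det s(z) = z`, and `s(z)` is `H`-unitary
whenever `σ z · z = 1`. [cite: PlatonovRapinchuk1994, §2.3 (unitary groups)] -/
theorem exists_section_of_anisotropic (hσ : ∀ x, σ (σ x) = x) (hH : (H.map σ)ᵀ = H)
    (hq : ((⇑σ ∘ v) ᵥ* H) ⬝ᵥ v ≠ 0) :
    ∃ s : K → Matrix n n K,
      (∀ z w, s (z * w) = s z * s w) ∧ s 1 = 1 ∧
      ∀ z : K, σ z * z = 1 → ((s z).map σ)ᵀ * H * s z = H ∧ (s z).det = z := by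
  set w : n → K := (⇑σ ∘ v) ᵥ* H with hw
  set q : K := w ⬝ᵥ v with hqdef
  refine ⟨fun z => 1 + ((z - 1) * q⁻¹) • vecMulVec v w, fun z z' => ?_, by simp, fun z hz => ⟨?_, ?_⟩⟩
  · -- multiplicativity: `(a + b + a b q) = (z z' − 1) q⁻¹` for `a = (z − 1) q⁻¹`, `b = (z' − 1) q⁻¹`
    have ha : (z * z' - 1) * q⁻¹ =
        (z - 1) * q⁻¹ + (z' - 1) * q⁻¹ + ((z - 1) * q⁻¹) * ((z' - 1) * q⁻¹) * q := by
      field_simp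
      ring
    show 1 + ((z * z' - 1) * q⁻¹) • vecMulVec v w =
      (1 + ((z - 1) * q⁻¹) • vecMulVec v w) * (1 + ((z' - 1) * q⁻¹) • vecMulVec v w)
    rw [one_add_smul_vecMulVec_mul, ← hqdef, ← ha]
  · -- unitarity: the adjoint identity with coefficient `σ a + a + σ a · a · q = (σ z · z − 1) q⁻¹ = 0`
    have hσq : σ q = q := conj_gram σ H v hσ hH
    have hcoef : σ ((z - 1) * q⁻¹) + (z - 1) * q⁻¹ + σ ((z - 1) * q⁻¹) * ((z - 1) * q⁻¹) * q = 0 := by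
      rw [map_mul, map_sub, map_one, map_inv₀, hσq]
      field_simp
      linear_combination hz
    rw [hw, conjTranspose_quasiReflection_mul σ H v hσ hH, ← hw, ← hqdef, hcoef, zero_smul, add_zero]
  · -- determinant: `1 + (z − 1) q⁻¹ q = z`
    rw [det_one_add_smul_vecMulVec, ← hqdef]
    field_simp
    ring

end Generic

/-! ## §2 A non-degenerate hermitian plane has an anisotropic vector -/

section Plane

variable {K : Type*} [Field K] [CharZero K] (σ : K →+* K) (H : Matrix (Fin 2) (Fin 2) K)

/-- **anisotropic vector of a non-degenerate hermitian plane** (`char K = 0`): if `(H.map σ)ᵀ = H` and `det H ≠ 0` there is `v ∈ K²` with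
`v̄ᵀ H v ≠ 0` — `e₀` if `H₀₀ ≠ 0`, `e₁` if `H₁₁ ≠ 0`, else `H = [[0, β], [σ β, 0]]` with `β σβ = −det H ≠ 0` and `v = (β, 1)` gives
`v̄ᵀ H v = 2 β σβ ≠ 0`. [cite: Rogawski1990, §1.9 p. 9] -/
theorem exists_anisotropic_fin_two (hH : (H.map σ)ᵀ = H) (hdet : H.det ≠ 0) :
    ∃ v : Fin 2 → K, ((⇑σ ∘ v) ᵥ* H) ⬝ᵥ v ≠ 0 := by
  rcases ne_or_eq (H 0 0) 0 with h00 | h00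
  · refine ⟨![1, 0], ?_⟩
    simpa only [vecMul, dotProduct, Fin.sum_univ_two, Fin.isValue, Function.comp_apply, Matrix.cons_val_zero, Matrix.cons_val_one,
      Matrix.cons_val_fin_one, Matrix.head_cons, map_one, map_zero, one_mul, zero_mul, mul_one, mul_zero, add_zero, zero_add] using h00
  rcases ne_or_eq (H 1 1) 0 with h11 | h11
  · refine ⟨![0, 1], ?_⟩
    simpa only [vecMul, dotProduct, Fin.sum_univ_two, Fin.isValue, Function.comp_apply, Matrix.cons_val_zero, Matrix.cons_val_one,
      Matrix.cons_val_fin_one, Matrix.head_cons, map_one, map_zero, one_mul, zero_mul, mul_one, mul_zero, add_zero, zero_add] using h11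
  -- hyperbolic plane: `H = [[0, β], [σ β, 0]]`
  have h10 : σ (H 0 1) = H 1 0 := by
    have := congrFun (congrFun hH 1) 0
    simpa only [transpose_apply, map_apply] using this
  have hprod : H 0 1 * H 1 0 ≠ 0 := by
    rw [det_fin_two, h00, h11, zero_mul, zero_sub, neg_ne_zero] at hdet
    exact hdet
  refine ⟨![H 0 1, 1], ?_⟩
  have h2 : (2 : K) * (H 0 1 * H 1 0) ≠ 0 := mul_ne_zero two_ne_zero hprod
  convert h2 using 1
  simp only [vecMul, dotProduct, Fin.sum_univ_two, Fin.isValue, Function.comp_apply, Matrix.cons_val_zero, Matrix.cons_val_one,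
    Matrix.cons_val_fin_one, map_one, one_mul, mul_one, mul_zero, add_zero, zero_add, h00, h11, h10]
  ring

end Plane

/-! ## §3 The head: payment of `sig_K2E5DetRationalSurjective` -/

/-- **`det : U(h)(L⁺) → L¹` has an explicit homomorphic section** — the socket `K2E5TamagawaUnitary.DetSection.sig_K2E5DetRationalSurjective`
TOKEN FOR TOKEN: for a CM field `L` (conjugation ★ `cmConjRingHom L`) and a non-degenerate hermitian `Ha ∈ M₂(L)` there is
`s : L → M₂(L)`, multiplicative on all of `L` with `s 1 = 1`, such that for every `z` with `z̄ z = 1` the matrix `s z` is `Ha`-unitary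
(`(s z)̄ᵀ Ha (s z) = Ha`) of determinant `z`; here `s z = 1 + (z − 1) q⁻¹ · v (v̄ᵀ Ha)` is the unitary quasi-reflection along an
anisotropic vector `v` (§1–§2), so no diagonalising basis and no Hilbert 90 is used.
[cite: Rogawski1990, §1.9 p. 9; §14.5 p. 238] [cite: PlatonovRapinchuk1994, §2.3 (unitary groups)] -/
theorem detRationalSurjective :
    ∀ (L : Type) [Field L] [NumberField L] [IsCMField L]
      (Ha : Matrix (Fin 2) (Fin 2) L) (_ : (Ha.map (cmConjRingHom L)).transpose = Ha) (_ : Ha.det ≠ 0),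
      ∃ s : L → Matrix (Fin 2) (Fin 2) L,
        (∀ z w, s (z * w) = s z * s w) ∧ s 1 = 1 ∧
        ∀ z : L, cmConjRingHom L z * z = 1 →
          ((s z).map (cmConjRingHom L))ᵀ * Ha * s z = Ha ∧ (s z).det = z := by
  intro L _ _ _ Ha hHa hdet
  have hσ : ∀ x : L, cmConjRingHom L (cmConjRingHom L x) = x := fun x => by
    simp only [cmConjRingHom_apply, IsCMField.complexConj_apply_apply]
  obtain ⟨v, hv⟩ := exists_anisotropic_fin_two (cmConjRingHom L) Ha hHa hdet
  exact exists_section_of_anisotropic (cmConjRingHom L) Ha v hσ hHa hv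

end Summit.HodgeConjecture.HodgeConjecture.Cruxes.H413.K2E5DetRationalSurjective

end
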